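import Mathlib
import Summits.HodgeConjecture.HodgeConjecture.Theses.CurveNetMordellWeil
import Literature.AlgebraicGeometry.HodgeTheory.MiddleDimensionReductionProofs
import Literature.AlgebraicGeometry.HodgeTheory.HodgeTypePullback
import Literature.AlgebraicGeometry.HodgeTheory.ComplexConjugationHolds
import Literature.AlgebraicGeometry.HodgeTheory.HodgeFiltrationModelsReductionProofs

/-!
# Crux `VerticalSupportBelowMiddle` (stmt-HodgeConjecture-2783), line `Sketch` — stub `stub_vsbm_upper`

The Hodge conjecture ABOVE the middle degree at fixed codimension `q` from the Hodge conjecture in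
the middle degree of `2q`-folds: for `n + d = 2q` and `X` smooth projective of dimension `n`, every
rational `(q,q)`-class of `X` is algebraic as soon as this holds on all smooth projective `2q`-folds.
Proof: `d` `ℙ¹`-steps `X ↦ X × ℙ¹` — the tree's
`mem_algebraicClasses_of_projectiveLine_of_preservesHodgeType` (`c = s_t^*(pr₁^* c)` for a general
slice, pull-backs of supports; Brosnan–Fang–Nie–Pearlstein 2009, Lemma 48, upper half, in its
Gysin-free form), the Hodge compatibility of `pr₁^*` being the tree's theorem
`preservesHodgeType_of_nonempty_hodgeModel` fed with `hodgePQ_independent_of_hodgeModel_holds` and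
`nonempty_hodgeModel_holds`. This replaces the route item `VerticalSupportAboveMiddle` in the line's
composition.
-/

noncomputable section

-- mandated namespace `Summit.HodgeConjecture.HodgeConjecture.Theorems` (single-problem summit: Problem =
-- Summit) trips `linter.dupNamespace`; off tree-wide in the lakefile, restated for stand-alone elaboration.
set_option linter.dupNamespace false

namespace Summit.HodgeConjecture.HodgeConjecture.Theorems

open CategoryTheory MonoidalCategory CartesianMonoidalCategory
open Literature.AlgebraicGeometry Literature.AlgebraicGeometry.Motives
  Literature.AlgebraicGeometry.HodgeTheory
open Summit.HodgeConjecture.HodgeConjecture.Theses.CurveNetMordellWeil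

/-- **Stub `stub_vsbm_upper` of line `Sketch` (crux `VerticalSupportBelowMiddle`)**: for
`n + d = 2q`, if every rational `(q,q)`-class on every smooth projective `2q`-fold is algebraic, then
so is every rational `(q,q)`-class on every smooth projective `n`-fold (induction on `d` by
`ℙ¹`-steps `c = s_t^*(pr₁^* c)` on `X × ℙ¹`, `mem_algebraicClasses_of_projectiveLine_of_preservesHodgeType`,
with `pr₁^*` preserving Hodge types by `preservesHodgeType_of_nonempty_hodgeModel`).
[cite: BrosnanFangNiePearlstein2009, §6 Lemma 48 (proof, upper half)] -/
theorem stub_vsbm_upper :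
    ∀ ⦃q : ℕ⦄ (d : ℕ) ⦃n : ℕ⦄, n + d = 2 * q →
      (∀ ⦃Y : SchemeOver ℂ⦄, IsSmoothProjective (2 * q) Y →
        Submodule.span ℂ {c : complexBetti Y (2 * q) |
          IsRationalClass c ∧ IsOfHodgeType (2 * q) Y (2 * q) q q c} ≤ algebraicClasses Y q) →
      ∀ ⦃X : SchemeOver ℂ⦄, IsSmoothProjective n X →
        Submodule.span ℂ {c : complexBetti X (2 * q) |
          IsRationalClass c ∧ IsOfHodgeType n X (2 * q) q q c} ≤ algebraicClasses X q := by
  intro q d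
  induction d with
  | zero =>
    intro n hn hmid X hX
    obtain rfl : n = 2 * q := by omega
    exact hmid hX
  | succ d ih =>
    intro n hn hmid X hX
    refine Submodule.span_le.2 ?_
    rintro c ⟨hc, hpp⟩
    have hXP : IsSmoothProjective (n + 1) (X ⊗ projectiveSpace 1 ℂ) :=
      IsSmoothProjective.tensor_holds hX (isSmoothProjective_projectiveSpace_holds ℂ 1)
    exact mem_algebraicClasses_of_projectiveLine_of_preservesHodgeType hX
      (preservesHodgeType_of_nonempty_hodgeModel hodgePQ_independent_of_hodgeModel_holds
        nonempty_hodgeModel_holds hXP hX (fst X (projectiveSpace 1 ℂ)))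
      (fun κ hκ hκpp => ih (n := n + 1) (by omega) hmid hXP (Submodule.subset_span ⟨hκ, hκpp⟩))
      c hc hpp

end Summit.HodgeConjecture.HodgeConjecture.Theorems

end
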